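/-
Copyright (c) 2026 the pub-hodgecm-mathlib formalisation cell (harness21).  Prover seat hodgecm-mathlib-K2E3-p11 (g7), Track B «K2-LIT» ∕ h413
(`stmt-HodgeConjecture-24833`), leaf (nsc-S-A′) «principal-block standard span», case brick C2 «cube» (architect K2E3-p25 (g2) `MEMO-SA-architecture.v2` §3,
dealer K2E3-plan (g4)), file C2b-wt: LETTERS AND WEIGHT TABLES OF THE CUBE.  2026-09-04.
-/
import Summits.HodgeConjecture.HodgeConjecture.Theorems.K2E3GL3CubeStandardModules      -- ★ C2a (K2E3-p11): `cube_letters_ne`, `theta_pi_eq`, `mul_nuHalf_mul_nuHalf(_inv)`, `isOpen_ker_nuOne`; brings ★ STD-EMB ∕ ONE-DIM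
import Summits.HodgeConjecture.HodgeConjecture.Theorems.K2E3GL3PrincipalSeriesRegular    -- ★ REG (K2E3-p23): `eq_of_tch_coe_eq`, `finrank_weightSpace_principalSeries_perm_eq_one`, `exists_perm_of_…_ne_zero`, `perm_theta_cases`
import HarnessLib

/-!
# K2_E3 road (h413), leaf (nsc-S-A′), case brick C2 «cube», file C2b-wt — letters and weight tables of the cube

Cell `pub/hodgecm-mathlib` (D-0151), Track B, seat K2E3-p11 (g7); architecture K2E3-p25 (g2) `MEMO-SA-architecture.v2` §3; C2 PLAN v1 (K2 bus 2026-09-04 11:36Z).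
`--supports stmt-HodgeConjecture-24833 --as helper`; THEOREMS ONLY (no definition ∕ instance ∕ notation ∕ named fact ∕ `sorry`); COUNT-NEUTRAL.

CURRENCY (★ H0-a ∕ ★ REG ∕ ★ ONE-DIM ∕ ★ STD-EMB ∕ ★ C2a): `T := Π a : Fin 3, GL {i // id i = a} F`, `tch θ := ∏ a, (θ a) ∘ det ∘ ev_a : T →* ℂ^×`, the weight
`wt θ : T → ℂ := fun m => (tch θ m : ℂ)`, `I θ := parabolicIndGL F id (𝟙.twist (tch θ))`, `mult V ζ := dim (r_B V)_ζ` (spelled out as ★ ADD), `ν := (unramifiedTwist F 1).toMonoidHom`,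
`ν½ := (unramifiedTwist F (1/2)).toMonoidHom`; the cube `θ_cube := ![a, aν, aν²]` and its six orderings `C₁ = ![a,aν,aν²]`, `C₂ = ![aν²,aν,a]`, `C₃ = ![a,aν²,aν]`,
`C₃′ = ![aν²,a,aν]`, `C₄ = ![aν,a,aν²]`, `C₄′ = ![aν,aν²,a]`; `π₁ := 𝟙.twist ((aν) ∘ det)` (★ ONE-DIM at `η = aν`); STD-EMB's parameter triples
`θ_D(η,ψ) := ![ην½⁻¹, ην½, ψ]` for `D := D(aν½, aν²)` and `D′ := D(aν ν½, a)`.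

CONTENT ([Zelevinsky1980, §1.1, Ex. 3.2, §9]; [BernsteinZelevinsky1977, §2.3, §2.12, Thm. 5.2]): §1 the letter identities turning GEO-QB's three weights of `D` ∕ `D′`
(`θ_D`, `θ_D ∘ (1 2)`, `θ_D ∘ (0 2 1)`) into cube orderings (`E(D) = {C₁, C₃, C₃′}`, `E(D′) = {C₄′, C₄, C₁}`), the open kernels of the letters and of `tch` of a triple,
and the injectivity of the six orderings (★ C2a `cube_letters_ne`); §2 the weight table of `I C` for orderings `C, C′` (`mult (I C) (wt C′) = 1`, ★ REG) and `= 0` off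
the six weights; §3 ★ ONE-DIM's table of `π₁` in cube letters: `mult π₁ (wt C₁) = 1`, `mult π₁ ζ = 0` for `ζ ≠ wt C₁`.
HONEST LABEL: HC_CM is proved only modulo the 7 printed citations (2 remaining named inputs: hLiu418 = stmt-HodgeConjecture-24832, h413 = stmt-HodgeConjecture-24833)
until rung 0 closes; count-neutral helper.

## Mathlib ∕ tree search
Tree ★: REG `finrank_weightSpace_principalSeries_perm_eq_one`∕`exists_perm_of_finrank_weightSpace_principalSeries_ne_zero`∕`perm_theta_cases`∕`eq_of_tch_coe_eq` · ONE-DIM `finrank_weightSpace_twist_det` ·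
C2a `cube_letters_ne`∕`theta_pi_eq`∕`mul_nuHalf_mul_nuHalf`∕`mul_nuHalf_mul_nuHalf_inv`∕`isOpen_ker_nuOne` · STD-EMB `isOpen_ker_tch`∕`isOpen_ker_mul_of_isOpen`.  Mathlib: `Matrix.cons_val_*`, `fin_cases`.
Dedup: `rg "CubeWeights|injective_cube_orderings|theta_D_swap_eq|finrank_weightSpace_pi_cube"` — none.

## References
* [Zelevinsky1980] A. V. Zelevinsky, *Induced representations of reductive p-adic groups II*, Ann. Sci. ÉNS 13 (1980), §1.1, Ex. 3.2, §9.
* [BernsteinZelevinsky1977] I. N. Bernstein, A. V. Zelevinsky, *Induced representations of reductive p-adic groups I*, Ann. Sci. ÉNS 10 (1977), §2.3, §2.12, Thm. 5.2.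
-/

set_option autoImplicit false
-- the mandated namespace repeats the single-problem summit's segment (`HodgeConjecture.HodgeConjecture`)
set_option linter.dupNamespace false

noncomputable section

open Module Function
open scoped MatrixGroups
open Literature.NumberTheory.Automorphic ValuativeRel Representation
open Literature.NumberTheory.GaloisRepresentations Literature.NumberTheory.GaloisRepresentations.IsNonarchimedeanLocalField
open Summit.HodgeConjecture.HodgeConjecture.Cruxes.H413.K2E3GL3StandardModuleEmbedding (isOpen_ker_tch isOpen_ker_mul_of_isOpen)
open Summit.HodgeConjecture.HodgeConjecture.Cruxes.H413.K2E3GL3CharacterJacquetExponent (finrank_weightSpace_twist_det)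
open Summit.HodgeConjecture.HodgeConjecture.Cruxes.H413.K2E3GL3CubeStandardModules
open Summit.HodgeConjecture.HodgeConjecture.Cruxes.H413.K2E3GL3PrincipalSeriesRegular

namespace Summit.HodgeConjecture.HodgeConjecture.Cruxes.H413.K2E3GL3CubeWeights

variable {F : Type} [Field F] [ValuativeRel F] [TopologicalSpace F] [IsNonarchimedeanLocalField F]

/-! ## §1 Letters: GEO-QB's triples in cube letters, open kernels, injectivity of the six orderings -/

section Letters

variable (a : Fˣ →* ℂˣ)

/-- A triple with pairwise distinct entries is injective. [folklore] -/
theorem injective_vecCons_three {α : Type*} (x y z : α) (hxy : x ≠ y) (hxz : x ≠ z) (hyz : y ≠ z) : Function.Injective (![x, y, z] : Fin 3 → α) := by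
  intro i j h
  fin_cases i <;> fin_cases j
  all_goals (first | rfl | (exfalso; simp at h; first | exact hxy h | exact hxz h | exact hyz h | exact hxy h.symm | exact hxz h.symm | exact hyz h.symm))

/-- **`E(D)` in cube letters, second weight**: `θ_D(aν½, aν²) ∘ (1 2) = ![aν½ν½⁻¹, aν², aν½ν½] = C₃ = ![a, aν², aν]`. [cite: Zelevinsky1980, §1.1] -/
theorem theta_D_swap_eq :
    (![a * ((unramifiedTwist F (1 / 2) : QuasiChar F).toMonoidHom) * ((unramifiedTwist F (1 / 2) : QuasiChar F).toMonoidHom)⁻¹,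
        a * ((unramifiedTwist F 1 : QuasiChar F).toMonoidHom) * ((unramifiedTwist F 1 : QuasiChar F).toMonoidHom),
        a * ((unramifiedTwist F (1 / 2) : QuasiChar F).toMonoidHom) * ((unramifiedTwist F (1 / 2) : QuasiChar F).toMonoidHom)] : Fin 3 → (Fˣ →* ℂˣ)) =
      ![a, a * ((unramifiedTwist F 1 : QuasiChar F).toMonoidHom) * ((unramifiedTwist F 1 : QuasiChar F).toMonoidHom), a * ((unramifiedTwist F 1 : QuasiChar F).toMonoidHom)] := by
  rw [mul_nuHalf_mul_nuHalf_inv, mul_nuHalf_mul_nuHalf]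

/-- **`E(D)` in cube letters, third weight**: `θ_D(aν½, aν²) ∘ (0 2 1) = ![aν², aν½ν½⁻¹, aν½ν½] = C₃′ = ![aν², a, aν]`. [cite: Zelevinsky1980, §1.1] -/
theorem theta_D_cycle_eq :
    (![a * ((unramifiedTwist F 1 : QuasiChar F).toMonoidHom) * ((unramifiedTwist F 1 : QuasiChar F).toMonoidHom),
        a * ((unramifiedTwist F (1 / 2) : QuasiChar F).toMonoidHom) * ((unramifiedTwist F (1 / 2) : QuasiChar F).toMonoidHom)⁻¹,
        a * ((unramifiedTwist F (1 / 2) : QuasiChar F).toMonoidHom) * ((unramifiedTwist F (1 / 2) : QuasiChar F).toMonoidHom)] : Fin 3 → (Fˣ →* ℂˣ)) =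
      ![a * ((unramifiedTwist F 1 : QuasiChar F).toMonoidHom) * ((unramifiedTwist F 1 : QuasiChar F).toMonoidHom), a, a * ((unramifiedTwist F 1 : QuasiChar F).toMonoidHom)] := by
  rw [mul_nuHalf_mul_nuHalf_inv, mul_nuHalf_mul_nuHalf]

/-- **`E(D′)` in cube letters, second weight**: `θ_D(aν ν½, a) ∘ (1 2) = ![aνν½ν½⁻¹, a, aνν½ν½] = C₄ = ![aν, a, aν²]`. [cite: Zelevinsky1980, §1.1] -/
theorem theta_D'_swap_eq :
    (![a * ((unramifiedTwist F 1 : QuasiChar F).toMonoidHom) * ((unramifiedTwist F (1 / 2) : QuasiChar F).toMonoidHom) * ((unramifiedTwist F (1 / 2) : QuasiChar F).toMonoidHom)⁻¹, a,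
        a * ((unramifiedTwist F 1 : QuasiChar F).toMonoidHom) * ((unramifiedTwist F (1 / 2) : QuasiChar F).toMonoidHom) * ((unramifiedTwist F (1 / 2) : QuasiChar F).toMonoidHom)] : Fin 3 → (Fˣ →* ℂˣ)) =
      ![a * ((unramifiedTwist F 1 : QuasiChar F).toMonoidHom), a, a * ((unramifiedTwist F 1 : QuasiChar F).toMonoidHom) * ((unramifiedTwist F 1 : QuasiChar F).toMonoidHom)] := by
  rw [mul_nuHalf_mul_nuHalf_inv, mul_nuHalf_mul_nuHalf]

/-- **`E(D′)` in cube letters, third weight**: `θ_D(aν ν½, a) ∘ (0 2 1) = ![a, aνν½ν½⁻¹, aνν½ν½] = C₁ = ![a, aν, aν²]`. [cite: Zelevinsky1980, §1.1] -/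
theorem theta_D'_cycle_eq :
    (![a, a * ((unramifiedTwist F 1 : QuasiChar F).toMonoidHom) * ((unramifiedTwist F (1 / 2) : QuasiChar F).toMonoidHom) * ((unramifiedTwist F (1 / 2) : QuasiChar F).toMonoidHom)⁻¹,
        a * ((unramifiedTwist F 1 : QuasiChar F).toMonoidHom) * ((unramifiedTwist F (1 / 2) : QuasiChar F).toMonoidHom) * ((unramifiedTwist F (1 / 2) : QuasiChar F).toMonoidHom)] : Fin 3 → (Fˣ →* ℂˣ)) =
      ![a, a * ((unramifiedTwist F 1 : QuasiChar F).toMonoidHom), a * ((unramifiedTwist F 1 : QuasiChar F).toMonoidHom) * ((unramifiedTwist F 1 : QuasiChar F).toMonoidHom)] := by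
  rw [mul_nuHalf_mul_nuHalf_inv, mul_nuHalf_mul_nuHalf]

variable (ha : IsOpen ((a.ker : Subgroup Fˣ) : Set Fˣ))

include ha in
/-- The letters `aν`, `aν²` have open kernels. [cite: Zelevinsky1980, §1.1] -/
theorem isOpen_ker_letters :
    IsOpen (((a * ((unramifiedTwist F 1 : QuasiChar F).toMonoidHom)).ker : Subgroup Fˣ) : Set Fˣ) ∧
      IsOpen (((a * ((unramifiedTwist F 1 : QuasiChar F).toMonoidHom) * ((unramifiedTwist F 1 : QuasiChar F).toMonoidHom)).ker : Subgroup Fˣ) : Set Fˣ) :=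
  ⟨isOpen_ker_mul_of_isOpen ha isOpen_ker_nuOne, isOpen_ker_mul_of_isOpen (isOpen_ker_mul_of_isOpen ha isOpen_ker_nuOne) isOpen_ker_nuOne⟩

omit [ValuativeRel F] [IsNonarchimedeanLocalField F] in
/-- The letters of a triple `![x,y,z]` with open kernels have open kernels (index form, as ★ REG consumes it). [folklore] -/
theorem isOpen_ker_vecCons_three (x y z : Fˣ →* ℂˣ) (hx : IsOpen ((x.ker : Subgroup Fˣ) : Set Fˣ)) (hy : IsOpen ((y.ker : Subgroup Fˣ) : Set Fˣ)) (hz : IsOpen ((z.ker : Subgroup Fˣ) : Set Fˣ))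
    (i : Fin 3) : IsOpen ((((![x, y, z] : Fin 3 → (Fˣ →* ℂˣ)) i).ker : Subgroup Fˣ) : Set Fˣ) := by
  fin_cases i <;> assumption

/-- `ker (tch ![x,y,z])` is open when the three letters have open kernels (★ STD-EMB `isOpen_ker_tch`). [cite: BernsteinZelevinsky1977, §2.3] -/
theorem isOpen_ker_tch_three (x y z : Fˣ →* ℂˣ) (hx : IsOpen ((x.ker : Subgroup Fˣ) : Set Fˣ)) (hy : IsOpen ((y.ker : Subgroup Fˣ) : Set Fˣ)) (hz : IsOpen ((z.ker : Subgroup Fˣ) : Set Fˣ)) :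
    IsOpen (((∏ i : Fin 3, ((![x, y, z] : Fin 3 → (Fˣ →* ℂˣ)) i).comp (Matrix.GeneralLinearGroup.det.comp
      (Pi.evalMonoidHom (fun a : Fin 3 => GL {i : Fin 3 // (id : Fin 3 → Fin 3) i = a} F) i)))).ker :
        Set (Π a : Fin 3, GL {i : Fin 3 // (id : Fin 3 → Fin 3) i = a} F)) :=
  isOpen_ker_tch _ (isOpen_ker_vecCons_three x y z hx hy hz)

/-- **The six orderings of the cube are injective triples** (letters pairwise distinct, ★ C2a `cube_letters_ne`), in the order `C₁, C₂, C₃, C₃′, C₄, C₄′`. [cite: Zelevinsky1980, §1.1, §9] -/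
theorem injective_cube_orderings :
    Function.Injective (![a, a * ((unramifiedTwist F 1 : QuasiChar F).toMonoidHom), a * ((unramifiedTwist F 1 : QuasiChar F).toMonoidHom) * ((unramifiedTwist F 1 : QuasiChar F).toMonoidHom)] : Fin 3 → (Fˣ →* ℂˣ)) ∧
    Function.Injective (![a * ((unramifiedTwist F 1 : QuasiChar F).toMonoidHom) * ((unramifiedTwist F 1 : QuasiChar F).toMonoidHom), a * ((unramifiedTwist F 1 : QuasiChar F).toMonoidHom), a] : Fin 3 → (Fˣ →* ℂˣ)) ∧
    Function.Injective (![a, a * ((unramifiedTwist F 1 : QuasiChar F).toMonoidHom) * ((unramifiedTwist F 1 : QuasiChar F).toMonoidHom), a * ((unramifiedTwist F 1 : QuasiChar F).toMonoidHom)] : Fin 3 → (Fˣ →* ℂˣ)) ∧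
    Function.Injective (![a * ((unramifiedTwist F 1 : QuasiChar F).toMonoidHom) * ((unramifiedTwist F 1 : QuasiChar F).toMonoidHom), a, a * ((unramifiedTwist F 1 : QuasiChar F).toMonoidHom)] : Fin 3 → (Fˣ →* ℂˣ)) ∧
    Function.Injective (![a * ((unramifiedTwist F 1 : QuasiChar F).toMonoidHom), a, a * ((unramifiedTwist F 1 : QuasiChar F).toMonoidHom) * ((unramifiedTwist F 1 : QuasiChar F).toMonoidHom)] : Fin 3 → (Fˣ →* ℂˣ)) ∧
    Function.Injective (![a * ((unramifiedTwist F 1 : QuasiChar F).toMonoidHom), a * ((unramifiedTwist F 1 : QuasiChar F).toMonoidHom) * ((unramifiedTwist F 1 : QuasiChar F).toMonoidHom), a] : Fin 3 → (Fˣ →* ℂˣ)) := by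
  obtain ⟨h1, h2, h3, -⟩ := cube_letters_ne a
  exact ⟨injective_vecCons_three _ _ _ h1.symm h2.symm h3.symm, injective_vecCons_three _ _ _ h3 h2 h1,
    injective_vecCons_three _ _ _ h2.symm h1.symm h3, injective_vecCons_three _ _ _ h2 h3 h1.symm,
    injective_vecCons_three _ _ _ h1 h3.symm h2.symm, injective_vecCons_three _ _ _ h3.symm h1 h2⟩

end Letters

/-! ## §2 The weight table of `I C` for orderings `C` of an injective triple (★ REG, folded for matrix-literal triples) -/

section PrincipalSeries

/-- **`mult (I ![x,y,z]) (wt θ′) = 1` for `θ′` a reordering** — ★ REG `finrank_weightSpace_principalSeries_perm_eq_one` with the open-kernel binder in letter form.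
[cite: BernsteinZelevinsky1977, §2.12, Thm. 5.2] -/
theorem finrank_weightSpace_I_three_perm_eq_one (x y z : Fˣ →* ℂˣ) (hx : IsOpen ((x.ker : Subgroup Fˣ) : Set Fˣ)) (hy : IsOpen ((y.ker : Subgroup Fˣ) : Set Fˣ)) (hz : IsOpen ((z.ker : Subgroup Fˣ) : Set Fˣ))
    (hinj : Function.Injective (![x, y, z] : Fin 3 → (Fˣ →* ℂˣ))) (σ : Equiv.Perm (Fin 3)) (θ' : Fin 3 → (Fˣ →* ℂˣ)) (hθ' : ∀ i, θ' i = (![x, y, z] : Fin 3 → (Fˣ →* ℂˣ)) (σ.symm i)) :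
    finrank ℂ ↥(⨅ m, Module.End.maxGenEigenspace (normalizedJacquetGL F (id : Fin 3 → Fin 3) (parabolicIndGL F (id : Fin 3 → Fin 3)
      ((Representation.trivial ℂ (Π a : Fin 3, GL {i : Fin 3 // (id : Fin 3 → Fin 3) i = a} F) ℂ).twist
        (∏ i : Fin 3, ((![x, y, z] : Fin 3 → (Fˣ →* ℂˣ)) i).comp (Matrix.GeneralLinearGroup.det.comp
          (Pi.evalMonoidHom (fun a : Fin 3 => GL {i : Fin 3 // (id : Fin 3 → Fin 3) i = a} F) i))))) m)
      ((((∏ i : Fin 3, (θ' i).comp (Matrix.GeneralLinearGroup.det.comp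
        (Pi.evalMonoidHom (fun a : Fin 3 => GL {i : Fin 3 // (id : Fin 3 → Fin 3) i = a} F) i))) m : ℂˣ) : ℂ))) = 1 :=
  finrank_weightSpace_principalSeries_perm_eq_one _ (isOpen_ker_vecCons_three x y z hx hy hz) hinj σ θ' hθ'

/-- **`mult (I ![x,y,z]) ζ = 0` off the six reorderings** (★ REG `exists_perm_of_finrank_weightSpace_principalSeries_ne_zero` + `perm_theta_cases`, contraposed; no injectivity needed).
[cite: BernsteinZelevinsky1977, Thm. 5.2] -/
theorem finrank_weightSpace_I_three_eq_zero (x y z : Fˣ →* ℂˣ) (hx : IsOpen ((x.ker : Subgroup Fˣ) : Set Fˣ)) (hy : IsOpen ((y.ker : Subgroup Fˣ) : Set Fˣ)) (hz : IsOpen ((z.ker : Subgroup Fˣ) : Set Fˣ))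
    (ζ : (Π a : Fin 3, GL {i : Fin 3 // (id : Fin 3 → Fin 3) i = a} F) → ℂ)
    (h : ∀ θ' : Fin 3 → (Fˣ →* ℂˣ), (θ' = ![x, y, z] ∨ θ' = ![x, z, y] ∨ θ' = ![y, x, z] ∨ θ' = ![y, z, x] ∨ θ' = ![z, x, y] ∨ θ' = ![z, y, x]) →
      ζ ≠ fun m => (((∏ i : Fin 3, (θ' i).comp (Matrix.GeneralLinearGroup.det.comp
        (Pi.evalMonoidHom (fun a : Fin 3 => GL {i : Fin 3 // (id : Fin 3 → Fin 3) i = a} F) i))) m : ℂˣ) : ℂ)) :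
    finrank ℂ ↥(⨅ m, Module.End.maxGenEigenspace (normalizedJacquetGL F (id : Fin 3 → Fin 3) (parabolicIndGL F (id : Fin 3 → Fin 3)
      ((Representation.trivial ℂ (Π a : Fin 3, GL {i : Fin 3 // (id : Fin 3 → Fin 3) i = a} F) ℂ).twist
        (∏ i : Fin 3, ((![x, y, z] : Fin 3 → (Fˣ →* ℂˣ)) i).comp (Matrix.GeneralLinearGroup.det.comp
          (Pi.evalMonoidHom (fun a : Fin 3 => GL {i : Fin 3 // (id : Fin 3 → Fin 3) i = a} F) i))))) m) (ζ m)) = 0 := by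
  by_contra hne
  obtain ⟨σ, hσ⟩ := exists_perm_of_finrank_weightSpace_principalSeries_ne_zero _ (isOpen_ker_vecCons_three x y z hx hy hz) ζ hne
  have hcases := perm_theta_cases (![x, y, z] : Fin 3 → (Fˣ →* ℂˣ)) σ
  simp only [Matrix.cons_val_zero, Matrix.cons_val_one, Matrix.cons_val] at hcases
  refine h (fun i => (![x, y, z] : Fin 3 → (Fˣ →* ℂˣ)) (σ.symm i)) ?_ (hσ.trans (funext fun m => rfl))
  rcases hcases with hc | hc | hc | hc | hc | hc <;> simp only [hc, true_or, or_true]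

end PrincipalSeries

/-! ## §3 The weight table of `π₁` in cube letters -/

section Pi

variable (a : Fˣ →* ℂˣ)

/-- **`mult π₁ (wt C₁) = 1`** for `π₁ = 𝟙.twist ((aν)∘det)` (★ ONE-DIM `finrank_weightSpace_twist_det` at `η = aν`; `θ_{aν} = ![aν ν⁻¹, aν, aν ν] = C₁` by ★ C2a `theta_pi_eq`).
[cite: Zelevinsky1980, Ex. 3.2, §1] [cite: BernsteinZelevinsky1977, §2.3] -/
theorem finrank_weightSpace_pi_cube_self :
    finrank ℂ ↥(⨅ m, Module.End.maxGenEigenspace (normalizedJacquetGL F (id : Fin 3 → Fin 3)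
      ((Representation.trivial ℂ (GL (Fin 3) F) ℂ).twist ((a * ((unramifiedTwist F 1 : QuasiChar F).toMonoidHom)).comp Matrix.GeneralLinearGroup.det)) m)
      ((((∏ i : Fin 3, ((![a, a * ((unramifiedTwist F 1 : QuasiChar F).toMonoidHom), a * ((unramifiedTwist F 1 : QuasiChar F).toMonoidHom) * ((unramifiedTwist F 1 : QuasiChar F).toMonoidHom)] : Fin 3 → (Fˣ →* ℂˣ)) i).comp
        (Matrix.GeneralLinearGroup.det.comp (Pi.evalMonoidHom (fun a : Fin 3 => GL {i : Fin 3 // (id : Fin 3 → Fin 3) i = a} F) i))) m : ℂˣ) : ℂ))) = 1 := by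
  classical
  rw [← theta_pi_eq a, finrank_weightSpace_twist_det, if_pos rfl]

/-- **`mult π₁ ζ = 0` for `ζ ≠ wt C₁`.** [cite: Zelevinsky1980, Ex. 3.2, §1] [cite: BernsteinZelevinsky1977, §2.3] -/
theorem finrank_weightSpace_pi_cube_eq_zero (ζ : (Π a : Fin 3, GL {i : Fin 3 // (id : Fin 3 → Fin 3) i = a} F) → ℂ)
    (hζ : ζ ≠ fun m => (((∏ i : Fin 3, ((![a, a * ((unramifiedTwist F 1 : QuasiChar F).toMonoidHom), a * ((unramifiedTwist F 1 : QuasiChar F).toMonoidHom) * ((unramifiedTwist F 1 : QuasiChar F).toMonoidHom)] : Fin 3 → (Fˣ →* ℂˣ)) i).comp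
        (Matrix.GeneralLinearGroup.det.comp (Pi.evalMonoidHom (fun a : Fin 3 => GL {i : Fin 3 // (id : Fin 3 → Fin 3) i = a} F) i))) m : ℂˣ) : ℂ)) :
    finrank ℂ ↥(⨅ m, Module.End.maxGenEigenspace (normalizedJacquetGL F (id : Fin 3 → Fin 3)
      ((Representation.trivial ℂ (GL (Fin 3) F) ℂ).twist ((a * ((unramifiedTwist F 1 : QuasiChar F).toMonoidHom)).comp Matrix.GeneralLinearGroup.det)) m) (ζ m)) = 0 := by
  classical
  rw [← theta_pi_eq a] at hζ
  rw [finrank_weightSpace_twist_det, if_neg hζ]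

end Pi

end Summit.HodgeConjecture.HodgeConjecture.Cruxes.H413.K2E3GL3CubeWeights

end
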